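import Summits.QuantumFields.BalabanUV.T4Continuum.Support.VectorGaugeCovarianceCarriers

/-!
# T⁴ programme, spine node NE2 (U1a), lane P2 — «V-GAUGE-COV», file 2: THE `ℓ²` ROTATION, THE SLICE SUBSPACE AND BAŁABAN's PROJECTED GAUGE FUNCTIONAL ARE
# GAUGE-COVARIANT; INVARIANCE OF THE ROAD's FORMS `ScV` ∕ `SfV` (model level; cell `pub-balaban`)

NE2 formalisation swarm `b2b-balaban-t4-ne2-formalise-*`, leaf prover 03 GEN 7 (`prover-b2b-balaban-t4-ne2-formalise-leaf-03-g7-0`); register row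
«P2-sup» of `t4/formal/NE2/LEAVES.md`; journal INTENT «V-GAUGE-COV» CLAIMS.log l.19543.  On top of file 1 (`VectorGaugeCovariance`: `gaugeR`, `gaugeS`, `gaugeW`,
`mulS`, `lapOp_gauge`, `divV_gauge`, `curlSq_gauge`) and of leaf-09-g7's `VariationalVectorGaugeSlice.{sliceSub, projG}` (p221888) BY NAME; Mathlib's
`Unitary.linearIsometryEquiv`, `LinearIsometryEquiv.piLpCongrRight`, `Submodule.starProjection_map_apply`.
 * §1 the `ℓ²` rotation `isoS u : PiLp 2 (Tor N → E) ≃ₗᵢ[ℂ] PiLp 2 (Tor N → E)`, `(isoS u v) x = u x (v x)` (one DATA `def`);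
 * §2 **`sliceSub_gauge`**: `S_{R^u}(K^u) = isoS u (S_R(K))` with `K^u = K.map (mulS u)` — the slice subspace is transported;
   **`projG_gauge`**: `projG (gaugeR u R) (K.map (mulS u)) (gaugeW u W) = projG R K W` — Bałaban's projected gauge functional is GAUGE-INVARIANT (any `R`, any `K`);
   with file 1b's `ker_avgOp_gauge` this is the invariance at the road's data `K = ker Q_{T′}`: **`projG_ker_gauge`**;
 * §3 **`ScV_gauge`** ∕ **`SfV_gauge`**: the road's forms are invariant for every pair of functionals with `G^u (W^u) = G W` (e.g. `projG` by §2, `0`, `landauG`-type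
   `divSq` by file 1).

HONEST FRAMING (T4-DAG p. 1).  Model level (c5); [folklore] algebra (orthogonal projections commute with linear isometries), NO analytic content; gauge EXISTENCE not
claimed; one data `def` (`isoS`), no `def … : Prop`, no `sorry`; axioms standard.  V-END with background ∕ NE2 NOT proved; NE3 OPEN; spine PROVED 0∕9 unchanged;
rung (B)+1 on a fixed finite T⁴ — NOT infinite volume, NOT mass gap, NOT Clay.  HONEST DEPENDENCY (cell, verbatim): continuum YM on T⁴ ⇐ BetaPertH ∧ nine spine
estimates (0/9 proved); BetaPertH ⇐ (D1) ∧ (D4) ∧ CAP+tail; G-an2-4 gates asym, D1 and NE2/3/4.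
-/

noncomputable section

namespace Summit.QuantumFields.BalabanUV.T4Continuum.VectorGaugeCovariance

open Finset WithLp
open scoped BigOperators
open Literature.MathematicalPhysics.QuantumFieldTheory.Balaban1983to89.B5Prop11Plancherel (Tor fine unitVec)
open Summit.QuantumFields.BalabanUV.T4Continuum.VariationalVectorForm (curlSq ScV SfV)
open Summit.QuantumFields.BalabanUV.T4Continuum.VariationalVectorWeitzenbock (divV)
open Summit.QuantumFields.BalabanUV.T4Continuum.VariationalVectorGaugeSlice (avgOp lapOp sliceSub mem_sliceSub projG)

variable {d : ℕ} {E : Type*} [NormedAddCommGroup E] [InnerProductSpace ℂ E] [CompleteSpace E]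

/-! ## §1 The `ℓ²` rotation -/

section Iso

variable (N : Fin d → ℕ) [∀ μ, NeZero (N μ)]

/-- **the `ℓ²` rotation** of 0-forms by a unitary site field: `(isoS u v) x = u x (v x)`, a linear isometric equivalence of `PiLp 2 (Tor N → E)`
(Mathlib's `piLpCongrRight` of the site-wise `Unitary.linearIsometryEquiv`). [folklore] -/
def isoS (u : Tor N → (E →L[ℂ] E)) (hu : ∀ x, u x ∈ unitary (E →L[ℂ] E)) : PiLp 2 (fun _ : Tor N => E) ≃ₗᵢ[ℂ] PiLp 2 (fun _ : Tor N => E) :=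
  LinearIsometryEquiv.piLpCongrRight 2 fun x => Unitary.linearIsometryEquiv ⟨u x, hu x⟩

variable {N} {u : Tor N → (E →L[ℂ] E)} (hu : ∀ x, u x ∈ unitary (E →L[ℂ] E))

/-- `isoS u v = toLp (gaugeS u (ofLp v))`. [folklore] -/
theorem isoS_apply (v : PiLp 2 (fun _ : Tor N => E)) : isoS N u hu v = toLp 2 (gaugeS N u (ofLp v)) := rfl

/-- `isoS u (toLp f) = toLp (gaugeS u f)`. [folklore] -/
theorem isoS_toLp (f : Tor N → E) : isoS N u hu (toLp 2 f) = toLp 2 (gaugeS N u f) := rfl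

/-- the inverse rotation: `(isoS u)⁻¹ v = toLp (gaugeS u⋆ (ofLp v))`. [folklore] -/
theorem isoS_symm_apply (v : PiLp 2 (fun _ : Tor N => E)) : (isoS N u hu).symm v = toLp 2 (gaugeS N (fun x => star (u x)) (ofLp v)) := by
  apply (isoS N u hu).injective
  rw [LinearIsometryEquiv.apply_symm_apply, isoS_toLp, gaugeS_gaugeS_star hu]

end Iso

/-! ## §2 The slice subspace and the projected gauge functional -/

section Slice

variable {N : Fin d → ℕ} [∀ μ, NeZero (N μ)] {u : Tor N → (E →L[ℂ] E)} (hu : ∀ x, u x ∈ unitary (E →L[ℂ] E))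
include hu

/-- **THE SLICE SUBSPACE IS TRANSPORTED**: `S_{R^u}(K.map (mulS u)) = (S_R(K)).map (isoS u)`. [folklore] -/
theorem sliceSub_gauge (R : Tor N → Fin d → (E →L[ℂ] E)) (K : Submodule ℂ (Tor N → E)) :
    sliceSub N (gaugeR N u R) (K.map (mulS N u)) = (sliceSub N R K).map ((isoS N u hu).toLinearEquiv : _ →ₗ[ℂ] _) := by
  ext v
  rw [Submodule.mem_map_equiv, mem_sliceSub, mem_sliceSub, Submodule.mem_map, Submodule.mem_map]
  have esymm : ofLp ((isoS N u hu).toLinearEquiv.symm v) = gaugeS N (fun x => star (u x)) (ofLp v) := by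
    have h := isoS_symm_apply hu v
    rw [← LinearIsometryEquiv.coe_symm_toLinearEquiv] at h
    exact congrArg ofLp h
  rw [esymm]
  constructor
  · rintro ⟨g, hg, hgv⟩
    rw [Submodule.mem_map] at hg
    obtain ⟨f, hf, rfl⟩ := hg
    refine ⟨f, hf, ?_⟩
    rw [mulS_apply, lapOp_gauge hu] at hgv
    rw [← hgv, gaugeS_star_gaugeS hu]
  · rintro ⟨f, hf, hfv⟩
    refine ⟨gaugeS N u f, Submodule.mem_map_of_mem hf, ?_⟩
    rw [lapOp_gauge hu, hfv, gaugeS_gaugeS_star hu]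

/-- the gauged divergence read in `ℓ²`: `toLp (div_{R^u} W^u) = isoS u (toLp (div_R W))`. [folklore] -/
theorem toLp_divV_gauge (R : Tor N → Fin d → (E →L[ℂ] E)) (W : Tor N → Fin d → E) :
    toLp 2 (divV N (gaugeR N u R) (gaugeW N u W)) = isoS N u hu (toLp 2 (divV N R W)) := by
  rw [isoS_toLp]
  congr 1
  funext x
  exact divV_gauge hu R W x

variable [FiniteDimensional ℂ E]

/-- **BAŁABAN's PROJECTED GAUGE FUNCTIONAL IS GAUGE-INVARIANT** (any transports `R`, any subspace `K` of 0-forms):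
`projG (gaugeR u R) (K.map (mulS u)) (gaugeW u W) = projG R K W`. [folklore] -/
theorem projG_gauge (R : Tor N → Fin d → (E →L[ℂ] E)) (K : Submodule ℂ (Tor N → E)) (W : Tor N → Fin d → E) :
    projG N (gaugeR N u R) (K.map (mulS N u)) (gaugeW N u W) = projG N R K W := by
  -- orthogonal projections commute with linear isometric equivalences (`Submodule.starProjection_map_apply`)
  have key : ∀ (S S' : Submodule ℂ (PiLp 2 (fun _ : Tor N => E))) (_ : S' = S.map ((isoS N u hu).toLinearEquiv : _ →ₗ[ℂ] _))
      (x : PiLp 2 (fun _ : Tor N => E)), ‖S'.starProjection (isoS N u hu x)‖ = ‖S.starProjection x‖ := by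
    rintro S S' rfl x
    rw [Submodule.starProjection_map_apply, LinearIsometryEquiv.symm_apply_apply, LinearIsometryEquiv.norm_map]
  unfold projG
  rw [toLp_divV_gauge hu, key _ _ (sliceSub_gauge hu R K)]

end Slice

section Road

variable (n : ℕ) [NeZero n] (M : Fin d → ℕ) [hM : ∀ μ, NeZero (M μ)] [FiniteDimensional ℂ E]
variable {v : Tor M → (E →L[ℂ] E)} (hv : ∀ y, v y ∈ unitary (E →L[ℂ] E))
variable {u : Tor (fine n M) → (E →L[ℂ] E)} (hu : ∀ x, u x ∈ unitary (E →L[ℂ] E))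
include hv hu

/-- **AT THE ROAD's DATA** (`K = ker Q_{T′}`): `projG (R^u) (ker Q_{T′^g}) (W^u) = projG R (ker Q_{T′}) W` — with file 1b's `ker_avgOp_gauge`. [folklore] -/
theorem projG_ker_gauge (R : Tor (fine n M) → Fin d → (E →L[ℂ] E)) (T' : Tor (fine n M) → (E →L[ℂ] E)) (W : Tor (fine n M) → Fin d → E) :
    projG (fine n M) (gaugeR (fine n M) u R) (LinearMap.ker (avgOp n M (gaugeF n M v u T'))) (gaugeW (fine n M) u W)
      = projG (fine n M) R (LinearMap.ker (avgOp n M T')) W := by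
  rw [ker_avgOp_gauge n M hu hv, projG_gauge hu]

end Road

/-! ## §3 The road's forms -/

section Forms

variable (n L : ℕ) [NeZero n] [NeZero L] (M : Fin d → ℕ) [hM : ∀ μ, NeZero (M μ)]

/-- **INVARIANCE OF THE COARSE FORM**: for functionals with `G^u (W^u) = G W`, `ScV n M (R^u) G^u (W^u) = ScV n M R G W`. [folklore] -/
theorem ScV_gauge {u : Tor (fine n M) → (E →L[ℂ] E)} (hu : ∀ x, u x ∈ unitary (E →L[ℂ] E)) (R : Tor (fine n M) → Fin d → (E →L[ℂ] E))
    {G Gu : (Tor (fine n M) → Fin d → E) → ℝ} (hG : ∀ W, Gu (gaugeW (fine n M) u W) = G W) (W : Tor (fine n M) → Fin d → E) :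
    ScV n M (gaugeR (fine n M) u R) Gu (gaugeW (fine n M) u W) = ScV n M R G W := by
  unfold ScV; rw [curlSq_gauge hu, hG]

/-- **INVARIANCE OF THE FINE FORM**: `SfV n L M (R′^u) G′^u (W′^u) = SfV n L M R′ G′ W′`. [folklore] -/
theorem SfV_gauge {u : Tor (fine L (fine n M)) → (E →L[ℂ] E)} (hu : ∀ x, u x ∈ unitary (E →L[ℂ] E))
    (R' : Tor (fine L (fine n M)) → Fin d → (E →L[ℂ] E)) {G' Gu' : (Tor (fine L (fine n M)) → Fin d → E) → ℝ}
    (hG : ∀ W', Gu' (gaugeW (fine L (fine n M)) u W') = G' W') (W' : Tor (fine L (fine n M)) → Fin d → E) :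
    SfV n L M (gaugeR (fine L (fine n M)) u R') Gu' (gaugeW (fine L (fine n M)) u W') = SfV n L M R' G' W' := by
  unfold SfV; rw [curlSq_gauge hu, hG]

/-- the functionals read on un-rotated fields: `G^u := G ∘ gaugeW u⋆` satisfies `G^u (W^u) = G W`. [folklore] -/
theorem comp_star_gauge {N : Fin d → ℕ} {u : Tor N → (E →L[ℂ] E)} (hu : ∀ x, u x ∈ unitary (E →L[ℂ] E)) (G : (Tor N → Fin d → E) → ℝ)
    (W : Tor N → Fin d → E) : G (gaugeW N (fun x => star (u x)) (gaugeW N u W)) = G W := by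
  rw [gaugeW_star_gaugeW hu]

end Forms

end Summit.QuantumFields.BalabanUV.T4Continuum.VectorGaugeCovariance

end
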